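import Literature.NumberTheory.Transcendental.QuadraticRelationsLogarithmsCor13
import Literature.NumberTheory.Transcendental.RationalSubspaces
import HarnessLib

/-!
# Roy–Waldschmidt 1997: Corollaire 1.3 from Théorème 1.1 (the printed deduction, pp. 758–759, PROVED)

Fourth step up the printed chain Théorème 0.2 ⇐ Théorème 0.1 ⇐ Corollaire 1.4 ⇐ Corollaire 1.3 ⇐
**Théorème 1.1** (the main theorem) of D. Roy, M. Waldschmidt, *Approximation diophantienne et
indépendance algébrique de logarithmes*, Ann. Sci. ÉNS (4) 30 (1997) 753–796.

* `RoyWaldschmidt1997.cor_1_3_of_thm_1_1` — **Corollaire 1.3 follows from Théorème 1.1**, the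
  latter as an explicit hypothesis rendered verbatim (pp. 755–756): "Soient `d₀` et `d₁` des
  entiers `≥ 0` de somme `d > 0`, soit `K ⊂ ℂ` un corps de degré de transcendance `≤ 1` sur `ℚ`,
  soit `W` un sous-`K`-espace vectoriel de `K^d`, soit `Y` un sous-groupe de `K^{d₀} × (𝓛_K)^{d₁}`
  de type fini, et soit `Y_a` un sous-groupe de `Y` contenu dans `K^{d₀} × 𝓛^{d₁}`.  On désigne par
  `n` la dimension du sous-espace de `ℂ^d` engendré par `W` et `Y`, et on suppose `d > 2n`.  On
  suppose aussi que `ℂ^d` est le seul sous-espace de `ℂ^d` qui contienne à la fois `W` et `Y` et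
  qui soit de la forme `T₀ × T₁` où `T₀` est un sous-espace de `ℂ^{d₀}` défini sur `K` et `T₁` un
  sous-espace de `ℂ^{d₁}` défini sur `ℚ`.  Alors, il existe des entiers `d₀'` et `d₁'`, tous deux
  `≥ 0` mais non tous deux nuls, et une application linéaire surjective
  `g : ℂ^{d₀} × ℂ^{d₁} → ℂ^{d₀'} × ℂ^{d₁'}` qui vérifie `g(K^{d₀} × 0) = K^{d₀'} × 0` et
  `g(0 × ℚ^{d₁}) = 0 × ℚ^{d₁'}`, tels qu'en posant `W' = g(W)`, `Y' = g(Y)`, `Y_a' = g(Y_a)`,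
  `d' = d₀' + d₁'`, `ℓ₀' = dim_K(W')`, `ℓ₁' = rang_ℤ(Y')`, `ℓ_a' = rang_ℤ(Y_a')` et en désignant
  par `n'` la dimension du sous-espace de `ℂ^{d'}` engendré par `W'` et `Y'`, on ait
  `d' > 2n' > ℓ₀'` et `d₁/(d − 2n) ≥ d₁'/(d' − 2n') ≥ ℓ₁'/(2n' − ℓ₀')` avec en plus l'inégalité
  stricte `d₁'/(d' − 2n') > ℓ₁'/(2n' − ℓ₀')` si `d₀' < n'`, ou `ℓ₀' < n'`, ou `ℓ_a' > 0`."
  Rendering: `K : IntermediateField ℚ ℂ` with `trdeg_ℚ K ≤ 1`; `𝓛_K = exp⁻¹(K^×)` ("`cexp z ∈ K`"),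
  `𝓛 = exp⁻¹(ℚ̄^×)` ("`cexp z` algebraic"); "défini sur `K`" = `LiePresentation.IsKRational K`,
  "défini sur `ℚ`" = `ratSpan`; the two image conditions as equalities of sets; the fractions
  cross-multiplied (denominators positive by `d > 2n`, `d' > 2n' > ℓ₀'`).
* `royWaldschmidt_quadratic_thm_0_2_of_thm_1_1` — hence the named fact follows from Théorème 1.1
  (through `royWaldschmidt_quadratic_thm_0_2_of_cor_1_3`).

Proof of Corollaire 1.3 as printed (p. 758 (a), (b) – p. 759): strong induction on `d₁`; (a) if a
smaller `d₁'` works, induct (the rational map is rescaled to an integer matrix so that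
`X' ⊆ (𝓛_K ∩ K)^{d₁'}`); (b) otherwise apply Théorème 1.1 with `d₀ = n`, `φ : ℂⁿ → ℂ^{d₁}` injective
defined over `K` with image `ℂX` (a basis of `ℂX` inside `X`; `X ⊆ φ(Kⁿ)` by span descent
`LiePresentation.kPoints_span_ofK`), `W = graph(φ|Kⁿ)`, `Y = {(x, φx) ; φx ∈ X}` and
`Y_a = Y ∩ (Kⁿ × 𝓛^{d₁})` (the text prints `Y_a = 0`, which would not give the strictness clause it
then states; the subgroup `Y ∩ (K^{d₀} × 𝓛^{d₁})` is the one the argument uses); `g = g₀ × g₁`,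
(b) forces `d₁' = d₁`, `d₀' = n' = n`, `g` bijective, and the conclusion reads
`d₁/(d₁ − n) ≥ ℓ₁/n`, strict if `X ∩ 𝓛^{d₁} ≠ 0`.

No definitions, no named facts (D-0026).

## References

* [RoyWaldschmidt1997ENS] D. Roy, M. Waldschmidt, Ann. Sci. ÉNS (4) 30 (1997) 753–796:
  Théorème 1.1 pp. 755–756, Corollaire 1.3 and its proof pp. 758–759
  (lit key paper:doi-10-1016-s0012-9593-97-89938-7, PDF pp. 4–5, 7–8; read on the rendered scan).
-/

noncomputable section

open Complex IntermediateField Module Submodule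

namespace Literature.NumberTheory.Transcendental

namespace RoyWaldschmidt1997

open LiePresentation

variable {a b : ℕ}

/-! ### Rational and `K`-structures: small lemmas -/

/-- A subspace containing all `K`-points is everything. [folklore] -/
theorem eq_top_of_forall_ofK_mem (K : IntermediateField ℚ ℂ) {m : ℕ} {T : Submodule ℂ (Fin m → ℂ)}
    (h : ∀ c : Fin m → K, ofK K (L := ℂ) c ∈ T) : T = ⊤ := by
  classical
  refine eq_top_iff.mpr fun w _ => ?_
  rw [pi_eq_sum_univ w]
  refine Submodule.sum_mem _ fun i _ => Submodule.smul_mem _ _ ?_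
  convert h (Pi.single i 1) using 1
  funext j
  by_cases hij : i = j
  · subst hij; simp
  · simp [hij]

/-- A subspace containing all rational points is everything. [folklore] -/
theorem eq_top_of_forall_rat_mem {m : ℕ} {T : Submodule ℂ (Fin m → ℂ)}
    (h : ∀ v : Fin m → ℚ, (fun j => ((v j : ℚ) : ℂ)) ∈ T) : T = ⊤ := by
  refine eq_top_iff.mpr ?_
  rw [← ratSpan_univ]
  exact span_le.mpr (by rintro _ ⟨v, -, rfl⟩; exact h v)

/-- A `ℂ`-linear map sending rational vectors to rational vectors is defined over `ℚ`: it is the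
complexification of a `ℚ`-linear map. [folklore] -/
theorem exists_ratStructure (g : (Fin a → ℂ) →ₗ[ℂ] (Fin b → ℂ))
    (h : ∀ v : Fin a → ℚ, ∃ w : Fin b → ℚ, g (fun j => ((v j : ℚ) : ℂ)) = fun i => ((w i : ℚ) : ℂ)) :
    ∃ g₀ : (Fin a → ℚ) →ₗ[ℚ] (Fin b → ℚ),
      ∀ v : Fin a → ℚ, g (fun j => ((v j : ℚ) : ℂ)) = fun i => ((g₀ v i : ℚ) : ℂ) := by
  choose f hf using h
  have hinj : Function.Injective (fun w : Fin b → ℚ => fun i => ((w i : ℚ) : ℂ)) := by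
    intro w w' hw
    funext i
    have := congrFun hw i
    simp only at this
    exact_mod_cast this
  refine ⟨{ toFun := f, map_add' := ?_, map_smul' := ?_ }, fun v => hf v⟩
  · intro v w
    apply hinj
    have : (fun j => (((v + w) j : ℚ) : ℂ)) = (fun j => ((v j : ℚ) : ℂ)) + fun j => ((w j : ℚ) : ℂ) := by
      funext j; simp
    show (fun i => ((f (v + w) i : ℚ) : ℂ)) = fun i => (((f v + f w) i : ℚ) : ℂ)
    rw [← hf, this, map_add, hf, hf]
    funext i; simp
  · intro c v
    apply hinj
    have : (fun j => (((c • v) j : ℚ) : ℂ)) = (c : ℂ) • fun j => ((v j : ℚ) : ℂ) := by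
      funext j; simp
    show (fun i => ((f (c • v) i : ℚ) : ℂ)) = fun i => (((c • f v) i : ℚ) : ℂ)
    rw [← hf, this, map_smul, hf]
    funext i; simp

/-- A `ℂ`-linear map sending `K`-points to `K`-points is defined over `K`. [folklore] -/
theorem exists_kStructure (K : IntermediateField ℚ ℂ) (g : (Fin a → ℂ) →ₗ[ℂ] (Fin b → ℂ))
    (h : ∀ v : Fin a → K, ∃ w : Fin b → K, g (ofK K v) = ofK K w) :
    ∃ g₀ : (Fin a → K) →ₗ[K] (Fin b → K), ∀ v : Fin a → K, g (ofK K v) = ofK K (g₀ v) := by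
  choose f hf using h
  have hinj : Function.Injective (ofK K (L := ℂ) (σ := Fin b)) := ofK_injective K
  refine ⟨{ toFun := f, map_add' := ?_, map_smul' := ?_ }, fun v => hf v⟩
  · intro v w
    apply hinj
    have : ofK K (L := ℂ) (v + w) = ofK K v + ofK K w := by funext j; simp
    rw [← hf, this, map_add, hf, hf]
    funext i; simp
  · intro c v
    apply hinj
    have : ofK K (L := ℂ) (c • v) = (c : ℂ) • ofK K v := by
      funext j; simp [Algebra.smul_def]
    rw [← hf, this, map_smul, hf]
    funext i; simp [Algebra.smul_def]

/-- Common denominator: finitely many rationals have a common positive integer multiple clearing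
all denominators. [folklore] -/
theorem exists_common_den {ι : Type*} [Fintype ι] (q : ι → ℚ) :
    ∃ N : ℕ, 0 < N ∧ ∀ k, ∃ z : ℤ, (N : ℚ) * q k = z := by
  classical
  refine ⟨∏ k, (q k).den, Finset.prod_pos fun k _ => (q k).den_pos, fun k => ?_⟩
  rw [← Finset.prod_erase_mul _ _ (Finset.mem_univ k)]
  refine ⟨(∏ k' ∈ Finset.univ.erase k, ((q k').den : ℤ)) * (q k).num, ?_⟩
  push_cast
  rw [mul_assoc, Rat.den_mul_eq_num]

/-- `exp` of an integer combination is a product of integer powers. [folklore] -/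
theorem cexp_sum_int_mul_mem (K : IntermediateField ℚ ℂ) {m : ℕ} (Z : Fin m → ℤ) {x : Fin m → ℂ}
    (hx : ∀ j, cexp (x j) ∈ K) : cexp (∑ j, (Z j : ℂ) * x j) ∈ K := by
  rw [Complex.exp_sum]
  refine prod_mem fun j _ => ?_
  rw [Complex.exp_int_mul]
  exact zpow_mem (hx j) _

/-- `exp` of an integer combination of numbers with algebraic exponentials is algebraic.
[folklore] -/
theorem isAlgebraic_cexp_sum_int_mul {m : ℕ} (Z : Fin m → ℤ) {x : Fin m → ℂ}
    (hx : ∀ j, IsAlgebraic ℚ (cexp (x j))) : IsAlgebraic ℚ (cexp (∑ j, (Z j : ℂ) * x j)) := by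
  have := isAlgebraic_cexp_sum_rat_mul hx (fun j => (Z j : ℚ))
  convert this using 3
  simp

/-- The vectors of `ℂ^m` all of whose coordinates have algebraic exponentials form a subgroup.
[folklore] -/
theorem exists_submodule_isAlgebraic_cexp (m : ℕ) :
    ∃ A : Submodule ℤ (Fin m → ℂ), ∀ v, v ∈ A ↔ ∀ j, IsAlgebraic ℚ (cexp (v j)) := by
  let A : Submodule ℤ (Fin m → ℂ) :=
    { carrier := {v | ∀ j, IsAlgebraic ℚ (cexp (v j))},
      add_mem' := fun {v w} hv hw j => by
        simp only [Pi.add_apply, Complex.exp_add]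
        exact (hv j).mul (hw j),
      zero_mem' := fun j => by
        simp only [Pi.zero_apply, Complex.exp_zero]; exact isAlgebraic_one,
      smul_mem' := fun c v hv j => by
        simp only [Pi.smul_apply, zsmul_eq_mul, Complex.exp_int_mul]
        have h1 : cexp (v j) ∈ algebraicClosure ℚ ℂ := (mem_algebraicClosure_iff).mpr (hv j)
        exact (mem_algebraicClosure_iff).mp (zpow_mem h1 c) }
  exact ⟨A, fun v => Iff.rfl⟩

/-- The finrank of an injective image. [folklore] -/
theorem finrank_map_of_injective {R M N : Type*} [Ring R] [AddCommGroup M] [Module R M]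
    [AddCommGroup N] [Module R N] (f : M →ₗ[R] N) (hf : Function.Injective f) (p : Submodule R M) :
    Module.finrank R ↥(p.map f) = Module.finrank R p :=
  (LinearEquiv.finrank_eq (Submodule.equivMapOfInjective f hf p)).symm

/-! ### A basis of `ℂX` inside `X`, and the map `φ` -/

/-- A finitely generated subgroup `X ≤ ℂ^{d}` contains a `ℂ`-basis `x₁, …, xₙ` of `ℂX`,
`n = dim ℂX`. [folklore] -/
theorem exists_basis_mem {m : ℕ} (X : Submodule ℤ (Fin m → ℂ)) :
    ∃ (n : ℕ) (x : Fin n → Fin m → ℂ), (∀ i, x i ∈ X) ∧ LinearIndependent ℂ x ∧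
      span ℂ (Set.range x) = span ℂ (X : Set (Fin m → ℂ)) ∧
      Module.finrank ℂ (span ℂ (X : Set (Fin m → ℂ))) = n := by
  classical
  obtain ⟨B, hBX, hBspan, hBli⟩ := exists_linearIndependent ℂ (X : Set (Fin m → ℂ))
  have hBfin : B.Finite := hBli.setFinite
  haveI : Fintype B := hBfin.fintype
  set n := Fintype.card B with hn
  let e : Fin n ≃ B := (Fintype.equivFin B).symm
  refine ⟨n, fun i => (e i : Fin m → ℂ), fun i => hBX (e i).2, ?_, ?_, ?_⟩
  · exact hBli.comp e e.injective
  · rw [← hBspan]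
    congr 1
    ext v
    constructor
    · rintro ⟨i, rfl⟩; exact (e i).2
    · intro hv; exact ⟨e.symm ⟨v, hv⟩, by simp⟩
  · rw [← hBspan, finrank_span_set_eq_card hBli, Set.toFinset_card]

/-! ### Corollaire 1.3, case (b): the application of Théorème 1.1 -/

set_option maxHeartbeats 800000 in
/-- **Case (b) of the proof of Corollaire 1.3** (pp. 758–759): if no smaller `d₁'` works, Théorème
1.1 applied to `d₀ = n`, `W = graph(φ|Kⁿ)`, `Y = {(x, φx) ; φx ∈ X}`, `Y_a = Y ∩ (Kⁿ × 𝓛^{d₁})`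
yields the conclusion of Corollaire 1.3 with `g₁ = id`.
[cite: RoyWaldschmidt1997ENS, proof of Corollaire 1.3 (b), pp. 758–759] -/
theorem cor_1_3_case_b
    (h11 : ∀ (K : IntermediateField ℚ ℂ), Algebra.trdeg ℚ K ≤ 1 →
      ∀ (d₀ d₁ : ℕ), 0 < d₀ + d₁ →
      ∀ (W : Submodule K ((Fin d₀ → ℂ) × (Fin d₁ → ℂ))),
        (∀ w ∈ W, (∀ i, w.1 i ∈ K) ∧ (∀ j, w.2 j ∈ K)) →
      ∀ (Y : Submodule ℤ ((Fin d₀ → ℂ) × (Fin d₁ → ℂ))), Y.FG →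
        (∀ y ∈ Y, (∀ i, y.1 i ∈ K) ∧ (∀ j, cexp (y.2 j) ∈ K)) →
      ∀ (Ya : Submodule ℤ ((Fin d₀ → ℂ) × (Fin d₁ → ℂ))), Ya ≤ Y →
        (∀ y ∈ Ya, ∀ j, IsAlgebraic ℚ (cexp (y.2 j))) →
      2 * Module.finrank ℂ (span ℂ ((W : Set ((Fin d₀ → ℂ) × (Fin d₁ → ℂ))) ∪ (Y : Set _))) < d₀ + d₁ →
      (∀ (T₀ : Submodule ℂ (Fin d₀ → ℂ)) (T₁ : Submodule ℂ (Fin d₁ → ℂ)),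
          IsKRational K T₀ → (∃ s : Set (Fin d₁ → ℚ), T₁ = ratSpan s) →
          (∀ w ∈ W, w.1 ∈ T₀ ∧ w.2 ∈ T₁) → (∀ y ∈ Y, y.1 ∈ T₀ ∧ y.2 ∈ T₁) → T₀ = ⊤ ∧ T₁ = ⊤) →
      ∃ (d₀' d₁' : ℕ) (g : ((Fin d₀ → ℂ) × (Fin d₁ → ℂ)) →ₗ[ℂ] ((Fin d₀' → ℂ) × (Fin d₁' → ℂ))),
        0 < d₀' + d₁' ∧ Function.Surjective g ∧
        g '' {p | (∀ i, p.1 i ∈ K) ∧ p.2 = 0} = {q | (∀ i, q.1 i ∈ K) ∧ q.2 = 0} ∧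
        g '' {p | p.1 = 0 ∧ ∀ j, p.2 j ∈ Set.range ((↑) : ℚ → ℂ)} =
          {q | q.1 = 0 ∧ ∀ j, q.2 j ∈ Set.range ((↑) : ℚ → ℂ)} ∧
        2 * Module.finrank ℂ (span ℂ ((W.map (g.restrictScalars K) : Set ((Fin d₀' → ℂ) × (Fin d₁' → ℂ))) ∪
              (Y.map (g.restrictScalars ℤ) : Set _))) < d₀' + d₁' ∧
        Module.finrank K ↥(W.map (g.restrictScalars K)) <
          2 * Module.finrank ℂ (span ℂ ((W.map (g.restrictScalars K) : Set ((Fin d₀' → ℂ) × (Fin d₁' → ℂ))) ∪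
              (Y.map (g.restrictScalars ℤ) : Set _))) ∧
        d₁' * (d₀ + d₁ - 2 * Module.finrank ℂ (span ℂ ((W : Set ((Fin d₀ → ℂ) × (Fin d₁ → ℂ))) ∪ (Y : Set _)))) ≤
          d₁ * (d₀' + d₁' - 2 * Module.finrank ℂ (span ℂ ((W.map (g.restrictScalars K) :
              Set ((Fin d₀' → ℂ) × (Fin d₁' → ℂ))) ∪ (Y.map (g.restrictScalars ℤ) : Set _)))) ∧
        Module.finrank ℤ ↥(Y.map (g.restrictScalars ℤ)) *
            (d₀' + d₁' - 2 * Module.finrank ℂ (span ℂ ((W.map (g.restrictScalars K) :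
              Set ((Fin d₀' → ℂ) × (Fin d₁' → ℂ))) ∪ (Y.map (g.restrictScalars ℤ) : Set _)))) ≤
          d₁' * (2 * Module.finrank ℂ (span ℂ ((W.map (g.restrictScalars K) :
              Set ((Fin d₀' → ℂ) × (Fin d₁' → ℂ))) ∪ (Y.map (g.restrictScalars ℤ) : Set _))) -
            Module.finrank K ↥(W.map (g.restrictScalars K))) ∧
        ((d₀' < Module.finrank ℂ (span ℂ ((W.map (g.restrictScalars K) :
              Set ((Fin d₀' → ℂ) × (Fin d₁' → ℂ))) ∪ (Y.map (g.restrictScalars ℤ) : Set _))) ∨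
          Module.finrank K ↥(W.map (g.restrictScalars K)) <
            Module.finrank ℂ (span ℂ ((W.map (g.restrictScalars K) :
              Set ((Fin d₀' → ℂ) × (Fin d₁' → ℂ))) ∪ (Y.map (g.restrictScalars ℤ) : Set _))) ∨
          0 < Module.finrank ℤ ↥(Ya.map (g.restrictScalars ℤ))) →
          Module.finrank ℤ ↥(Y.map (g.restrictScalars ℤ)) *
              (d₀' + d₁' - 2 * Module.finrank ℂ (span ℂ ((W.map (g.restrictScalars K) :
                Set ((Fin d₀' → ℂ) × (Fin d₁' → ℂ))) ∪ (Y.map (g.restrictScalars ℤ) : Set _)))) <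
            d₁' * (2 * Module.finrank ℂ (span ℂ ((W.map (g.restrictScalars K) :
                Set ((Fin d₀' → ℂ) × (Fin d₁' → ℂ))) ∪ (Y.map (g.restrictScalars ℤ) : Set _))) -
              Module.finrank K ↥(W.map (g.restrictScalars K)))))
    (K : IntermediateField ℚ ℂ) (hK : Algebra.trdeg ℚ K = 1) (d₁ : ℕ) (hd₁ : 0 < d₁)
    (X : Submodule ℤ (Fin d₁ → ℂ)) (hX : X.FG) (hXK : ∀ x ∈ X, ∀ i, x i ∈ K ∧ cexp (x i) ∈ K)
    (hn : Module.finrank ℂ (span ℂ (X : Set (Fin d₁ → ℂ))) < d₁)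
    (hirr : ∀ s : Set (Fin d₁ → ℚ), X ≤ (ratSpan s).restrictScalars ℤ → ratSpan s = ⊤)
    (hnot : ¬ ∃ d₁' : ℕ, d₁' < d₁ ∧ ∃ (g : (Fin d₁ → ℂ) →ₗ[ℂ] (Fin d₁' → ℂ))
      (g₀ : (Fin d₁ → ℚ) →ₗ[ℚ] (Fin d₁' → ℚ)), Function.Surjective g ∧
      (∀ v : Fin d₁ → ℚ, g (fun j => ((v j : ℚ) : ℂ)) = fun i => ((g₀ v i : ℚ) : ℂ)) ∧
      Module.finrank ℂ (span ℂ (X.map (g.restrictScalars ℤ) : Set (Fin d₁' → ℂ))) < d₁' ∧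
      d₁ * Module.finrank ℂ (span ℂ (X.map (g.restrictScalars ℤ) : Set (Fin d₁' → ℂ))) ≤
        d₁' * Module.finrank ℂ (span ℂ (X : Set (Fin d₁ → ℂ)))) :
    0 < Module.finrank ℂ (span ℂ (X : Set (Fin d₁ → ℂ))) ∧
    Module.finrank ℤ ↥X * d₁ ≤
      Module.finrank ℂ (span ℂ (X : Set (Fin d₁ → ℂ))) * (d₁ + Module.finrank ℤ ↥X) ∧
    ((∃ x ∈ X, x ≠ 0 ∧ ∀ i, IsAlgebraic ℚ (cexp (x i))) →
      Module.finrank ℤ ↥X * d₁ <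
        Module.finrank ℂ (span ℂ (X : Set (Fin d₁ → ℂ))) * (d₁ + Module.finrank ℤ ↥X)) := by
  classical
  -- (B1) a basis `x` of `ℂX` inside `X`
  obtain ⟨n, x, hxX, hxli, hxspan, hfr⟩ := exists_basis_mem X
  rw [hfr] at hn hnot ⊢
  haveI : Nonempty (Fin d₁) := ⟨⟨0, hd₁⟩⟩
  -- `n > 0`
  have hn0 : 0 < n := by
    by_contra h0
    push Not at h0
    have hn' : n = 0 := Nat.le_zero.mp h0
    subst hn'
    have hbot : span ℂ (X : Set (Fin d₁ → ℂ)) = ⊥ := by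
      rw [← hxspan, Set.range_eq_empty, Submodule.span_empty]
    have hXle : X ≤ (ratSpan (∅ : Set (Fin d₁ → ℚ))).restrictScalars ℤ := by
      intro ξ hξ
      have : ξ ∈ span ℂ (X : Set (Fin d₁ → ℂ)) := subset_span hξ
      rw [hbot, Submodule.mem_bot] at this
      rw [this]; exact Submodule.zero_mem _
    have := hirr ∅ hXle
    rw [ratSpan_empty] at this
    exact bot_ne_top this
  -- (B2) `K`-versions of the `x i`, the map `φ` and its `K`-form
  have hxK : ∀ i j, x i j ∈ K := fun i j => (hXK _ (hxX i) j).1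
  set xK : Fin n → Fin d₁ → K := fun i j => ⟨x i j, hxK i j⟩ with hxKdef
  have hxK_eq : ∀ i, ofK K (L := ℂ) (xK i) = x i := fun i => funext fun j => rfl
  set φ : (Fin n → ℂ) →ₗ[ℂ] (Fin d₁ → ℂ) := Fintype.linearCombination ℂ x with hφ
  have hφ_apply : ∀ c, φ c = ∑ i, c i • x i := fun c => Fintype.linearCombination_apply ℂ x c
  have hφinj : Function.Injective φ := hxli.fintypeLinearCombination_injective
  have hφrange : LinearMap.range φ = span ℂ (X : Set (Fin d₁ → ℂ)) := by
    rw [hφ, Fintype.range_linearCombination, hxspan]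
  set φK : (Fin n → K) →ₗ[K] (Fin d₁ → K) := Fintype.linearCombination K xK with hφK
  have hφ_ofK : ∀ c : Fin n → K, φ (ofK K c) = ofK K (φK c) := by
    intro c
    rw [hφ_apply, hφK, Fintype.linearCombination_apply]
    funext j
    simp only [Finset.sum_apply, Pi.smul_apply, smul_eq_mul, ofK_apply, map_sum, map_mul]
    refine Finset.sum_congr rfl fun i _ => ?_
    rw [← hxK_eq i, ofK_apply]
  -- `X ⊆ φ(Kⁿ)` (span descent)
  have hXφ : ∀ ξ ∈ X, ∃ c : Fin n → K, φ (ofK K c) = ξ := by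
    intro ξ hξ
    have hξK : ∀ j, ξ j ∈ K := fun j => (hXK ξ hξ j).1
    set ξK : Fin d₁ → K := fun j => ⟨ξ j, hξK j⟩
    have hξeq : ofK K (L := ℂ) ξK = ξ := funext fun j => rfl
    have h1 : ξK ∈ kPoints K (span ℂ (ofK K (L := ℂ) '' Set.range xK)) := by
      rw [mem_kPoints, hξeq]
      have : ofK K (L := ℂ) '' Set.range xK = Set.range x := by
        ext v; constructor
        · rintro ⟨_, ⟨i, rfl⟩, rfl⟩; exact ⟨i, (hxK_eq i).symm⟩
        · rintro ⟨i, rfl⟩; exact ⟨xK i, ⟨i, rfl⟩, hxK_eq i⟩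
      rw [this, hxspan]; exact subset_span hξ
    rw [kPoints_span_ofK] at h1
    obtain ⟨c, hc⟩ := (Submodule.mem_span_range_iff_exists_fun K).mp h1
    refine ⟨c, ?_⟩
    rw [hφ_ofK, ← hξeq, ← hc, hφK, Fintype.linearCombination_apply]
  -- (B3) the `K`-linear map `ψ : c ↦ (c, φ c)` and `W = ψ(Kⁿ)`
  set ι : (Fin n → K) →ₗ[K] (Fin n → ℂ) :=
    { toFun := ofK K, map_add' := fun v w => by funext j; simp,
      map_smul' := fun c v => by funext j; simp [Algebra.smul_def] } with hι
  have hι_apply : ∀ c, ι c = ofK K c := fun c => rfl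
  set ψ : (Fin n → K) →ₗ[K] ((Fin n → ℂ) × (Fin d₁ → ℂ)) :=
    LinearMap.prod ι ((φ.restrictScalars K).comp ι) with hψ
  have hψ_apply : ∀ c, ψ c = (ofK K c, φ (ofK K c)) := fun c => rfl
  have hψinj : Function.Injective ψ := by
    intro c c' h
    have := congrArg Prod.fst h
    rw [hψ_apply, hψ_apply] at this
    exact ofK_injective K this
  set W : Submodule K ((Fin n → ℂ) × (Fin d₁ → ℂ)) := LinearMap.range ψ with hW
  have hmemW : ∀ p, p ∈ W ↔ ∃ c, (ofK K c, φ (ofK K c)) = p := fun p => by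
    rw [hW, LinearMap.mem_range]
    simp only [hψ_apply]
  -- `Y = {(x, φ x) ∈ W ; φ x ∈ X}` and `Y_a = Y ∩ (Kⁿ × 𝓛^{d₁})`
  obtain ⟨A, hA⟩ := exists_submodule_isAlgebraic_cexp d₁
  set sndZ : ((Fin n → ℂ) × (Fin d₁ → ℂ)) →ₗ[ℤ] (Fin d₁ → ℂ) := (LinearMap.snd ℂ _ _).restrictScalars ℤ
    with hsndZ
  set Y : Submodule ℤ ((Fin n → ℂ) × (Fin d₁ → ℂ)) := W.restrictScalars ℤ ⊓ X.comap sndZ with hY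
  set Ya : Submodule ℤ ((Fin n → ℂ) × (Fin d₁ → ℂ)) := Y ⊓ A.comap sndZ with hYa
  have hmemY : ∀ p, p ∈ Y ↔ p ∈ W ∧ p.2 ∈ X := fun p => by
    rw [hY, Submodule.mem_inf, Submodule.restrictScalars_mem, Submodule.mem_comap]; rfl
  have hmemYa : ∀ p, p ∈ Ya ↔ p ∈ Y ∧ ∀ j, IsAlgebraic ℚ (cexp (p.2 j)) := fun p => by
    rw [hYa, Submodule.mem_inf, Submodule.mem_comap, hA]; rfl
  -- every `ξ ∈ X` lifts to `Y`
  have hlift : ∀ ξ ∈ X, ∃ c : Fin n → K, (ofK K c, ξ) ∈ Y ∧ φ (ofK K c) = ξ := by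
    intro ξ hξ
    obtain ⟨c, hc⟩ := hXφ ξ hξ
    refine ⟨c, (hmemY _).mpr ⟨(hmemW _).mpr ⟨c, by rw [hc]⟩, hξ⟩, hc⟩
  -- (B4) hypotheses of Théorème 1.1
  have hWK : ∀ w ∈ W, (∀ i, w.1 i ∈ K) ∧ (∀ j, w.2 j ∈ K) := by
    intro w hw
    obtain ⟨c, rfl⟩ := (hmemW w).mp hw
    refine ⟨fun i => by simp [ofK_apply], fun j => ?_⟩
    show φ (ofK K c) j ∈ K
    rw [hφ_ofK]; simp [ofK_apply]
  have hYK : ∀ y ∈ Y, (∀ i, y.1 i ∈ K) ∧ (∀ j, cexp (y.2 j) ∈ K) := by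
    intro y hy
    obtain ⟨hyW, hyX⟩ := (hmemY y).mp hy
    exact ⟨(hWK y hyW).1, fun j => (hXK _ hyX j).2⟩
  have hYaY : Ya ≤ Y := inf_le_left
  have hYaalg : ∀ y ∈ Ya, ∀ j, IsAlgebraic ℚ (cexp (y.2 j)) := fun y hy => ((hmemYa y).mp hy).2
  -- `snd` is injective on `W`, so `Y ≅ X` and `Y` is finitely generated
  have hsnd_inj : ∀ p ∈ W, ∀ q ∈ W, p.2 = q.2 → p = q := by
    intro p hp q hq h
    obtain ⟨c, rfl⟩ := (hmemW p).mp hp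
    obtain ⟨c', rfl⟩ := (hmemW q).mp hq
    simp only at h
    have : ofK K (L := ℂ) c = ofK K c' := hφinj h
    rw [this]
  haveI hXfin : Module.Finite ℤ X := Module.Finite.iff_fg.mpr hX
  have hYmap : Y.map sndZ = X := by
    refine le_antisymm ?_ ?_
    · rintro _ ⟨p, hp, rfl⟩; exact ((hmemY p).mp hp).2
    · intro ξ hξ
      obtain ⟨c, hc, -⟩ := hlift ξ hξ
      exact ⟨_, hc, rfl⟩
  have hYinj : Set.InjOn sndZ Y := fun p hp q hq h =>
    hsnd_inj p ((hmemY p).mp hp).1 q ((hmemY q).mp hq).1 h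
  -- the restriction of `snd` to `Y` as an injective map onto `X`
  set θ : Y →ₗ[ℤ] (Fin d₁ → ℂ) := sndZ.comp Y.subtype with hθ
  have hθinj : Function.Injective θ := by
    intro p q h
    exact Subtype.ext (hYinj p.2 q.2 h)
  have hθrange : LinearMap.range θ = X := by
    rw [hθ, LinearMap.range_comp, Submodule.range_subtype, hYmap]
  have hYX : Y ≃ₗ[ℤ] X :=
    (LinearEquiv.ofInjective θ hθinj).trans (LinearEquiv.ofEq _ _ hθrange)
  haveI : Module.Finite ℤ Y := Module.Finite.equiv hYX.symm
  have hYfg : Y.FG := Module.Finite.iff_fg.mp inferInstance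
  -- `span_ℂ (W ∪ Y) = range of c ↦ (c, φ c)`, of dimension `n`
  set Ψ : (Fin n → ℂ) →ₗ[ℂ] ((Fin n → ℂ) × (Fin d₁ → ℂ)) := LinearMap.prod LinearMap.id φ with hΨ
  have hΨinj : Function.Injective Ψ := fun c c' h => congrArg Prod.fst h
  have hspanWY : span ℂ ((W : Set ((Fin n → ℂ) × (Fin d₁ → ℂ))) ∪ (Y : Set _)) = LinearMap.range Ψ := by
    refine le_antisymm (span_le.mpr ?_) ?_
    · rintro p (hp | hp)
      · obtain ⟨c, rfl⟩ := (hmemW p).mp hp; exact ⟨ofK K c, rfl⟩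
      · obtain ⟨c, rfl⟩ := (hmemW p).mp ((hmemY p).mp hp).1; exact ⟨ofK K c, rfl⟩
    · rintro _ ⟨c, rfl⟩
      have hc : c ∈ (⊤ : Submodule ℂ (Fin n → ℂ)) := trivial
      rw [← eq_top_of_forall_ofK_mem K (T := (span ℂ ((W : Set ((Fin n → ℂ) × (Fin d₁ → ℂ))) ∪
        (Y : Set _))).comap Ψ) (fun c' => ?_)] at hc
      · exact hc
      · exact subset_span (Or.inl ((hmemW _).mpr ⟨c', rfl⟩))
  have hnWY : Module.finrank ℂ (span ℂ ((W : Set ((Fin n → ℂ) × (Fin d₁ → ℂ))) ∪ (Y : Set _))) = n := by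
    rw [hspanWY, LinearMap.finrank_range_of_inj hΨinj, Module.finrank_fin_fun]
  -- irreducibility
  have hirr' : ∀ (T₀ : Submodule ℂ (Fin n → ℂ)) (T₁ : Submodule ℂ (Fin d₁ → ℂ)),
      IsKRational K T₀ → (∃ s : Set (Fin d₁ → ℚ), T₁ = ratSpan s) →
      (∀ w ∈ W, w.1 ∈ T₀ ∧ w.2 ∈ T₁) → (∀ y ∈ Y, y.1 ∈ T₀ ∧ y.2 ∈ T₁) → T₀ = ⊤ ∧ T₁ = ⊤ := by
    intro T₀ T₁ _ ⟨s, hs⟩ hWT _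
    refine ⟨eq_top_of_forall_ofK_mem K fun c => (hWT _ ((hmemW _).mpr ⟨c, rfl⟩)).1, ?_⟩
    rw [hs]
    refine hirr s fun ξ hξ => ?_
    obtain ⟨c, hc⟩ := hXφ ξ hξ
    have := (hWT _ ((hmemW _).mpr ⟨c, rfl⟩)).2
    rw [hs] at this
    simpa [hc] using this
  -- (B5) apply Théorème 1.1 with `d₀ = n`
  have hK' : Algebra.trdeg ℚ K ≤ 1 := hK.le
  have hlt : 2 * Module.finrank ℂ (span ℂ ((W : Set ((Fin n → ℂ) × (Fin d₁ → ℂ))) ∪ (Y : Set _))) < n + d₁ := by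
    rw [hnWY]; omega
  obtain ⟨d₀', d₁', g, hdpos, hgsurj, hgK, hgQ, h2n', hℓ₀', hineq1, hineq2, hstrict⟩ :=
    h11 K hK' n d₁ (by omega) W hWK Y hYfg hYK Ya hYaY hYaalg hlt hirr'
  rw [hnWY] at hineq1
  -- abbreviations
  set W' := W.map (g.restrictScalars K) with hW'
  set Y' := Y.map (g.restrictScalars ℤ) with hY'
  set Ya' := Ya.map (g.restrictScalars ℤ) with hYa'
  set n' := Module.finrank ℂ (span ℂ ((W' : Set ((Fin d₀' → ℂ) × (Fin d₁' → ℂ))) ∪ (Y' : Set _))) with hn'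
  set ℓ₀' := Module.finrank K ↥W' with hℓ₀'def
  set ℓ₁' := Module.finrank ℤ ↥Y' with hℓ₁'def
  set ℓa' := Module.finrank ℤ ↥Ya' with hℓa'def
  -- (B6) block structure of `g`
  have hg2 : ∀ u : Fin n → ℂ, (g (u, 0)).2 = 0 := by
    intro u
    have key : ∀ c : Fin n → K, (g (ofK K c, 0)).2 = 0 := by
      intro c
      have : g (ofK K c, 0) ∈ g '' {p | (∀ i, p.1 i ∈ K) ∧ p.2 = 0} :=
        ⟨(ofK K c, 0), ⟨fun i => by simp [ofK_apply], rfl⟩, rfl⟩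
      rw [hgK] at this
      exact this.2
    have htop := eq_top_of_forall_ofK_mem K
      (T := LinearMap.ker ((LinearMap.snd ℂ _ _).comp (g.comp (LinearMap.inl ℂ _ _)))) fun c => key c
    have : u ∈ LinearMap.ker ((LinearMap.snd ℂ _ _).comp (g.comp (LinearMap.inl ℂ _ _))) := by
      rw [htop]; trivial
    exact this
  have hg1 : ∀ v : Fin d₁ → ℂ, (g (0, v)).1 = 0 := by
    intro v
    have key : ∀ q : Fin d₁ → ℚ, (g (0, fun j => ((q j : ℚ) : ℂ))).1 = 0 := by
      intro q
      have : g (0, fun j => ((q j : ℚ) : ℂ)) ∈ g '' {p | p.1 = 0 ∧ ∀ j, p.2 j ∈ Set.range ((↑) : ℚ → ℂ)} :=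
        ⟨(0, fun j => ((q j : ℚ) : ℂ)), ⟨rfl, fun j => ⟨q j, rfl⟩⟩, rfl⟩
      rw [hgQ] at this
      exact this.1
    have htop := eq_top_of_forall_rat_mem
      (T := LinearMap.ker ((LinearMap.fst ℂ _ _).comp (g.comp (LinearMap.inr ℂ _ _)))) fun q => key q
    have : v ∈ LinearMap.ker ((LinearMap.fst ℂ _ _).comp (g.comp (LinearMap.inr ℂ _ _))) := by
      rw [htop]; trivial
    exact this
  set g₀ : (Fin n → ℂ) →ₗ[ℂ] (Fin d₀' → ℂ) := (LinearMap.fst ℂ _ _).comp (g.comp (LinearMap.inl ℂ _ _)) with hg₀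
  set g₁ : (Fin d₁ → ℂ) →ₗ[ℂ] (Fin d₁' → ℂ) := (LinearMap.snd ℂ _ _).comp (g.comp (LinearMap.inr ℂ _ _)) with hg₁
  have hg_apply : ∀ p, g p = (g₀ p.1, g₁ p.2) := by
    rintro ⟨u, v⟩
    have : g (u, v) = g (u, 0) + g (0, v) := by rw [← map_add]; simp
    rw [this]
    ext1
    · simp only [Prod.fst_add, hg1 v, add_zero]; rfl
    · simp only [Prod.snd_add, hg2 u, zero_add]; rfl
  -- `g₁` is defined over `ℚ` and surjective; `g₀` is surjective
  have hg₁rat : ∀ q : Fin d₁ → ℚ, ∃ w : Fin d₁' → ℚ, g₁ (fun j => ((q j : ℚ) : ℂ)) = fun i => ((w i : ℚ) : ℂ) := by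
    intro q
    have : g (0, fun j => ((q j : ℚ) : ℂ)) ∈ g '' {p | p.1 = 0 ∧ ∀ j, p.2 j ∈ Set.range ((↑) : ℚ → ℂ)} :=
      ⟨(0, fun j => ((q j : ℚ) : ℂ)), ⟨rfl, fun j => ⟨q j, rfl⟩⟩, rfl⟩
    rw [hgQ] at this
    obtain ⟨-, h2⟩ := this
    choose w hw using h2
    exact ⟨w, funext fun i => (hw i).symm⟩
  obtain ⟨g₁₀, hg₁₀⟩ := exists_ratStructure g₁ hg₁rat
  have hg₁surj : Function.Surjective g₁ := by
    rw [← LinearMap.range_eq_top]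
    refine eq_top_of_forall_rat_mem fun w => ?_
    have : ((0 : Fin d₀' → ℂ), fun i => ((w i : ℚ) : ℂ)) ∈ g '' {p | p.1 = 0 ∧ ∀ j, p.2 j ∈ Set.range ((↑) : ℚ → ℂ)} := by
      rw [hgQ]; exact ⟨rfl, fun i => ⟨w i, rfl⟩⟩
    obtain ⟨p, ⟨hp1, -⟩, hp⟩ := this
    refine ⟨p.2, ?_⟩
    have := congrArg Prod.snd hp
    rw [hg_apply] at this
    simpa [hp1] using this
  have hg₀surj : Function.Surjective g₀ := by
    rw [← LinearMap.range_eq_top]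
    refine eq_top_of_forall_ofK_mem K fun c' => ?_
    have : (ofK K (L := ℂ) c', (0 : Fin d₁' → ℂ)) ∈ g '' {p | (∀ i, p.1 i ∈ K) ∧ p.2 = 0} := by
      rw [hgK]; exact ⟨fun i => by simp [ofK_apply], rfl⟩
    obtain ⟨p, ⟨-, hp2⟩, hp⟩ := this
    refine ⟨p.1, ?_⟩
    have := congrArg Prod.fst hp
    rw [hg_apply] at this
    simpa [hp2] using this
  -- dimension counts: `d₀' ≤ n`, `d₁' ≤ d₁`
  have hd₀'n : d₀' ≤ n := by
    have := LinearMap.finrank_range_le g₀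
    rw [LinearMap.range_eq_top.mpr hg₀surj, finrank_top, Module.finrank_fin_fun, Module.finrank_fin_fun] at this
    exact this
  have hd₁'d₁ : d₁' ≤ d₁ := by
    have := LinearMap.finrank_range_le g₁
    rw [LinearMap.range_eq_top.mpr hg₁surj, finrank_top, Module.finrank_fin_fun, Module.finrank_fin_fun] at this
    exact this
  -- `n' ≥ d₀'`: the first projection of `span W'` is everything
  have hspanW'le : span ℂ (W' : Set ((Fin d₀' → ℂ) × (Fin d₁' → ℂ))) ≤
      span ℂ ((W' : Set ((Fin d₀' → ℂ) × (Fin d₁' → ℂ))) ∪ (Y' : Set _)) := span_mono Set.subset_union_left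
  have hn'd₀' : d₀' ≤ n' := by
    have h1 : (span ℂ (W' : Set ((Fin d₀' → ℂ) × (Fin d₁' → ℂ)))).map (LinearMap.fst ℂ _ _) = ⊤ := by
      refine eq_top_of_forall_ofK_mem K fun c' => ?_
      obtain ⟨u, hu⟩ := hg₀surj (ofK K c')
      -- `u ∈ ℂⁿ = span of K-points`; use linearity through the comap
      have hmem : ∀ c : Fin n → K, g₀ (ofK K c) ∈
          (span ℂ (W' : Set ((Fin d₀' → ℂ) × (Fin d₁' → ℂ)))).map (LinearMap.fst ℂ _ _) := by
        intro c
        refine ⟨g (ofK K c, φ (ofK K c)), subset_span ⟨(ofK K c, φ (ofK K c)), (hmemW _).mpr ⟨c, rfl⟩, rfl⟩, ?_⟩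
        rw [hg_apply]; rfl
      have htop := eq_top_of_forall_ofK_mem K
        (T := ((span ℂ (W' : Set ((Fin d₀' → ℂ) × (Fin d₁' → ℂ)))).map (LinearMap.fst ℂ _ _)).comap g₀) hmem
      have : u ∈ ((span ℂ (W' : Set ((Fin d₀' → ℂ) × (Fin d₁' → ℂ)))).map (LinearMap.fst ℂ _ _)).comap g₀ := by
        rw [htop]; trivial
      rw [Submodule.mem_comap, hu] at this
      exact this
    have h2 := Submodule.finrank_map_le (LinearMap.fst ℂ (Fin d₀' → ℂ) (Fin d₁' → ℂ))
      (span ℂ (W' : Set ((Fin d₀' → ℂ) × (Fin d₁' → ℂ))))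
    rw [h1, finrank_top, Module.finrank_fin_fun] at h2
    exact h2.trans (Submodule.finrank_mono hspanW'le)
  -- `m := dim ℂ g₁(X) ≤ n'`
  have hXg₁le : span ℂ (X.map (g₁.restrictScalars ℤ) : Set (Fin d₁' → ℂ)) ≤
      (span ℂ ((W' : Set ((Fin d₀' → ℂ) × (Fin d₁' → ℂ))) ∪ (Y' : Set _))).map (LinearMap.snd ℂ _ _) := by
    refine span_le.mpr ?_
    rintro _ ⟨ξ, hξ, rfl⟩
    obtain ⟨c, hcY, hc⟩ := hlift ξ hξ
    refine ⟨g (ofK K c, ξ), subset_span (Or.inr ⟨(ofK K c, ξ), hcY, rfl⟩), ?_⟩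
    rw [hg_apply]; rfl
  have hm_le : Module.finrank ℂ (span ℂ (X.map (g₁.restrictScalars ℤ) : Set (Fin d₁' → ℂ))) ≤ n' :=
    (Submodule.finrank_mono hXg₁le).trans (Submodule.finrank_map_le _ _)
  -- numerical consequences of Théorème 1.1: `d₁' > n' > 0` and `d₁ n' ≤ d₁' n`
  have hn'pos : 0 < n' := by omega
  have hd₁'n' : n' < d₁' := by omega
  have hkey : d₁ * n' ≤ d₁' * n := by
    -- from `d₁' (n + d₁ - 2 n) ≤ d₁ (d₀' + d₁' - 2 n')` and `d₀' ≤ n'`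
    have h1 : d₁' * (d₁ - n) ≤ d₁ * (d₁' - n') := by
      have e1 : n + d₁ - 2 * n = d₁ - n := by omega
      rw [e1] at hineq1
      exact hineq1.trans (Nat.mul_le_mul_left _ (by omega))
    have h2 : d₁' * (d₁ - n) + d₁' * n = d₁' * d₁ := by rw [← Nat.mul_add]; congr 1; omega
    have h3 : d₁ * (d₁' - n') + d₁ * n' = d₁ * d₁' := by rw [← Nat.mul_add]; congr 1; omega
    nlinarith
  -- (b): `d₁' = d₁`, `g₁` bijective
  have hd₁' : d₁' = d₁ := by
    by_contra hne
    have hlt' : d₁' < d₁ := lt_of_le_of_ne hd₁'d₁ hne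
    exact hnot ⟨d₁', hlt', g₁, g₁₀, hg₁surj, hg₁₀, lt_of_le_of_lt hm_le hd₁'n',
      (Nat.mul_le_mul_left _ hm_le).trans hkey⟩
  have hg₁inj : Function.Injective g₁ := by
    subst hd₁'
    exact (LinearMap.injective_iff_surjective (f := g₁)).mpr hg₁surj
  -- hence `m = n`, `n' = n`, `d₀' = n`, `g₀` bijective, `g` injective
  have hm_eq : Module.finrank ℂ (span ℂ (X.map (g₁.restrictScalars ℤ) : Set (Fin d₁' → ℂ))) = n := by
    have : span ℂ (X.map (g₁.restrictScalars ℤ) : Set (Fin d₁' → ℂ)) = (span ℂ (X : Set (Fin d₁ → ℂ))).map g₁ := by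
      rw [Submodule.map_span]; rfl
    rw [this, finrank_map_of_injective g₁ hg₁inj, hfr]
  have hn'n : n' = n := by
    have h1 : n ≤ n' := hm_eq ▸ hm_le
    have h2 : d₁ * n' ≤ d₁ * n := by rw [hd₁'] at hkey; exact hkey
    have h3 : n' ≤ n := Nat.le_of_mul_le_mul_left h2 hd₁
    omega
  have hd₀' : d₀' = n := by
    have h1 : d₁' * (d₁ - n) ≤ d₁ * (d₀' + d₁' - 2 * n') := by
      have e1 : n + d₁ - 2 * n = d₁ - n := by omega
      rw [e1] at hineq1; exact hineq1
    rw [hd₁', hn'n] at h1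
    have h2 : d₁ - n ≤ d₀' + d₁ - 2 * n := Nat.le_of_mul_le_mul_left h1 hd₁
    omega
  have hg₀inj : Function.Injective g₀ := by
    subst hd₀'
    exact (LinearMap.injective_iff_surjective (f := g₀)).mpr hg₀surj
  have hginj : Function.Injective g := by
    rintro ⟨u, v⟩ ⟨u', v'⟩ h
    rw [hg_apply, hg_apply] at h
    simp only [Prod.mk.injEq] at h
    rw [hg₀inj h.1, hg₁inj h.2]
  -- `ℓ₀' = n`, `ℓ₁' = rang X`, and `ℓ_a' > 0` when `X ∩ 𝓛 ≠ 0`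
  have hℓ₀' : ℓ₀' = n := by
    have hKinj : Function.Injective (g.restrictScalars K) := hginj
    rw [hℓ₀'def, hW', finrank_map_of_injective _ hKinj, hW, LinearMap.finrank_range_of_inj hψinj,
      Module.finrank_fin_fun]
  have hℓ₁' : ℓ₁' = Module.finrank ℤ ↥X := by
    have hZinj : Function.Injective (g.restrictScalars ℤ) := hginj
    rw [hℓ₁'def, hY', finrank_map_of_injective _ hZinj]
    exact LinearEquiv.finrank_eq hYX
  have hℓa' : (∃ x ∈ X, x ≠ 0 ∧ ∀ i, IsAlgebraic ℚ (cexp (x i))) → 0 < ℓa' := by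
    rintro ⟨ξ, hξ, hξ0, hξalg⟩
    have hZinj : Function.Injective (g.restrictScalars ℤ) := hginj
    rw [hℓa'def, hYa', finrank_map_of_injective _ hZinj]
    obtain ⟨c, hcY, hc⟩ := hlift ξ hξ
    have hmem : (ofK K c, ξ) ∈ Ya := (hmemYa _).mpr ⟨hcY, hξalg⟩
    haveI : Module.Finite ℤ Ya := Module.Finite.of_injective (Submodule.inclusion hYaY) (Submodule.inclusion_injective hYaY)
    haveI : Module.Free ℤ Ya := Module.free_of_finite_type_torsion_free'
    refine Module.finrank_pos_iff_exists_ne_zero.mpr ⟨⟨(ofK K c, ξ), hmem⟩, ?_⟩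
    intro h0
    have := congrArg (fun p : Ya => (p : (Fin n → ℂ) × (Fin d₁ → ℂ)).2) h0
    exact hξ0 (by simpa using this)
  -- conclusion
  rw [hn'n, hd₁', hd₀'] at hineq2 hstrict
  rw [show ℓ₀' = n from hℓ₀'] at hineq2 hstrict
  rw [show ℓ₁' = Module.finrank ℤ ↥X from hℓ₁'] at hineq2 hstrict
  have e2 : n + d₁ - 2 * n = d₁ - n := by omega
  have e3 : 2 * n - n = n := by omega
  rw [e2, e3] at hineq2 hstrict
  refine ⟨hn0, ?_, fun hXL => ?_⟩
  · -- `ℓ₁ (d₁ - n) ≤ d₁ n` ⇒ `ℓ₁ d₁ ≤ n (d₁ + ℓ₁)`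
    have : Module.finrank ℤ ↥X * (d₁ - n) + Module.finrank ℤ ↥X * n = Module.finrank ℤ ↥X * d₁ := by
      rw [← Nat.mul_add]; congr 1; omega
    nlinarith
  · have hs := hstrict (Or.inr (Or.inr (hℓa' hXL)))
    have : Module.finrank ℤ ↥X * (d₁ - n) + Module.finrank ℤ ↥X * n = Module.finrank ℤ ↥X * d₁ := by
      rw [← Nat.mul_add]; congr 1; omega
    nlinarith

/-! ### Corollaire 1.3 from Théorème 1.1 -/

/-- Spans are unchanged by rescaling the map by a non-zero scalar. [folklore] -/
theorem span_map_smul_eq {d d' : ℕ} (X : Submodule ℤ (Fin d → ℂ)) (g : (Fin d → ℂ) →ₗ[ℂ] (Fin d' → ℂ))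
    {c : ℂ} (hc : c ≠ 0) :
    span ℂ (X.map ((c • g).restrictScalars ℤ) : Set (Fin d' → ℂ)) =
      span ℂ (X.map (g.restrictScalars ℤ) : Set (Fin d' → ℂ)) := by
  refine le_antisymm (span_le.mpr ?_) (span_le.mpr ?_)
  · rintro _ ⟨x, hx, rfl⟩
    exact Submodule.smul_mem _ c (subset_span ⟨x, hx, rfl⟩)
  · rintro _ ⟨x, hx, rfl⟩
    have : g x = c⁻¹ • (c • g) x := by simp [smul_smul, inv_mul_cancel₀ hc]
    rw [LinearMap.restrictScalars_apply, this]
    exact Submodule.smul_mem _ _ (subset_span ⟨x, hx, rfl⟩)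

/-- `ofK ℚ` is the coordinatewise cast. [folklore] -/
theorem ofK_rat_eq {k : ℕ} (v : Fin k → ℚ) : ofK ℚ (L := ℂ) v = fun j => ((v j : ℚ) : ℂ) := by
  funext j; simp [ofK_apply]

set_option maxHeartbeats 800000 in
/-- **Corollaire 1.3 follows from Théorème 1.1** (Roy–Waldschmidt 1997, pp. 758–759, as printed:
strong induction on `d₁`, case (a) through a smaller `d₁'` with the rational map rescaled to an
integer matrix, case (b) = `cor_1_3_case_b`).  The conclusion is Corollaire 1.3 verbatim in the
rendering of `cor_1_4_of_cor_1_3`.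
[cite: RoyWaldschmidt1997ENS, Théorème 1.1 pp. 755–756; Corollaire 1.3 and proof pp. 758–759] -/
theorem cor_1_3_of_thm_1_1
    (h11 : ∀ (K : IntermediateField ℚ ℂ), Algebra.trdeg ℚ K ≤ 1 →
      ∀ (d₀ d₁ : ℕ), 0 < d₀ + d₁ →
      ∀ (W : Submodule K ((Fin d₀ → ℂ) × (Fin d₁ → ℂ))),
        (∀ w ∈ W, (∀ i, w.1 i ∈ K) ∧ (∀ j, w.2 j ∈ K)) →
      ∀ (Y : Submodule ℤ ((Fin d₀ → ℂ) × (Fin d₁ → ℂ))), Y.FG →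
        (∀ y ∈ Y, (∀ i, y.1 i ∈ K) ∧ (∀ j, cexp (y.2 j) ∈ K)) →
      ∀ (Ya : Submodule ℤ ((Fin d₀ → ℂ) × (Fin d₁ → ℂ))), Ya ≤ Y →
        (∀ y ∈ Ya, ∀ j, IsAlgebraic ℚ (cexp (y.2 j))) →
      2 * Module.finrank ℂ (span ℂ ((W : Set ((Fin d₀ → ℂ) × (Fin d₁ → ℂ))) ∪ (Y : Set _))) < d₀ + d₁ →
      (∀ (T₀ : Submodule ℂ (Fin d₀ → ℂ)) (T₁ : Submodule ℂ (Fin d₁ → ℂ)),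
          IsKRational K T₀ → (∃ s : Set (Fin d₁ → ℚ), T₁ = ratSpan s) →
          (∀ w ∈ W, w.1 ∈ T₀ ∧ w.2 ∈ T₁) → (∀ y ∈ Y, y.1 ∈ T₀ ∧ y.2 ∈ T₁) → T₀ = ⊤ ∧ T₁ = ⊤) →
      ∃ (d₀' d₁' : ℕ) (g : ((Fin d₀ → ℂ) × (Fin d₁ → ℂ)) →ₗ[ℂ] ((Fin d₀' → ℂ) × (Fin d₁' → ℂ))),
        0 < d₀' + d₁' ∧ Function.Surjective g ∧
        g '' {p | (∀ i, p.1 i ∈ K) ∧ p.2 = 0} = {q | (∀ i, q.1 i ∈ K) ∧ q.2 = 0} ∧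
        g '' {p | p.1 = 0 ∧ ∀ j, p.2 j ∈ Set.range ((↑) : ℚ → ℂ)} =
          {q | q.1 = 0 ∧ ∀ j, q.2 j ∈ Set.range ((↑) : ℚ → ℂ)} ∧
        2 * Module.finrank ℂ (span ℂ ((W.map (g.restrictScalars K) : Set ((Fin d₀' → ℂ) × (Fin d₁' → ℂ))) ∪
              (Y.map (g.restrictScalars ℤ) : Set _))) < d₀' + d₁' ∧
        Module.finrank K ↥(W.map (g.restrictScalars K)) <
          2 * Module.finrank ℂ (span ℂ ((W.map (g.restrictScalars K) : Set ((Fin d₀' → ℂ) × (Fin d₁' → ℂ))) ∪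
              (Y.map (g.restrictScalars ℤ) : Set _))) ∧
        d₁' * (d₀ + d₁ - 2 * Module.finrank ℂ (span ℂ ((W : Set ((Fin d₀ → ℂ) × (Fin d₁ → ℂ))) ∪ (Y : Set _)))) ≤
          d₁ * (d₀' + d₁' - 2 * Module.finrank ℂ (span ℂ ((W.map (g.restrictScalars K) :
              Set ((Fin d₀' → ℂ) × (Fin d₁' → ℂ))) ∪ (Y.map (g.restrictScalars ℤ) : Set _)))) ∧
        Module.finrank ℤ ↥(Y.map (g.restrictScalars ℤ)) *
            (d₀' + d₁' - 2 * Module.finrank ℂ (span ℂ ((W.map (g.restrictScalars K) :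
              Set ((Fin d₀' → ℂ) × (Fin d₁' → ℂ))) ∪ (Y.map (g.restrictScalars ℤ) : Set _)))) ≤
          d₁' * (2 * Module.finrank ℂ (span ℂ ((W.map (g.restrictScalars K) :
              Set ((Fin d₀' → ℂ) × (Fin d₁' → ℂ))) ∪ (Y.map (g.restrictScalars ℤ) : Set _))) -
            Module.finrank K ↥(W.map (g.restrictScalars K))) ∧
        ((d₀' < Module.finrank ℂ (span ℂ ((W.map (g.restrictScalars K) :
              Set ((Fin d₀' → ℂ) × (Fin d₁' → ℂ))) ∪ (Y.map (g.restrictScalars ℤ) : Set _))) ∨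
          Module.finrank K ↥(W.map (g.restrictScalars K)) <
            Module.finrank ℂ (span ℂ ((W.map (g.restrictScalars K) :
              Set ((Fin d₀' → ℂ) × (Fin d₁' → ℂ))) ∪ (Y.map (g.restrictScalars ℤ) : Set _))) ∨
          0 < Module.finrank ℤ ↥(Ya.map (g.restrictScalars ℤ))) →
          Module.finrank ℤ ↥(Y.map (g.restrictScalars ℤ)) *
              (d₀' + d₁' - 2 * Module.finrank ℂ (span ℂ ((W.map (g.restrictScalars K) :
                Set ((Fin d₀' → ℂ) × (Fin d₁' → ℂ))) ∪ (Y.map (g.restrictScalars ℤ) : Set _)))) <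
            d₁' * (2 * Module.finrank ℂ (span ℂ ((W.map (g.restrictScalars K) :
                Set ((Fin d₀' → ℂ) × (Fin d₁' → ℂ))) ∪ (Y.map (g.restrictScalars ℤ) : Set _))) -
              Module.finrank K ↥(W.map (g.restrictScalars K)))))
    :
    ∀ (K : IntermediateField ℚ ℂ), Algebra.trdeg ℚ K = 1 →
      ∀ (d : ℕ), 0 < d → ∀ (X : Submodule ℤ (Fin d → ℂ)), X.FG →
        (∀ x ∈ X, ∀ i, x i ∈ K ∧ cexp (x i) ∈ K) →
        Module.finrank ℂ (span ℂ (X : Set (Fin d → ℂ))) < d →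
        (∀ s : Set (Fin d → ℚ), X ≤ (ratSpan s).restrictScalars ℤ → ratSpan s = ⊤) →
        ∃ (d' : ℕ) (g : (Fin d → ℂ) →ₗ[ℂ] (Fin d' → ℂ)) (g₀ : (Fin d → ℚ) →ₗ[ℚ] (Fin d' → ℚ)),
          0 < d' ∧ Function.Surjective g ∧
          (∀ v : Fin d → ℚ, g (fun j => ((v j : ℚ) : ℂ)) = fun i => ((g₀ v i : ℚ) : ℂ)) ∧
          Module.finrank ℂ (span ℂ (X.map (g.restrictScalars ℤ) : Set (Fin d' → ℂ))) < d' ∧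
          0 < Module.finrank ℂ (span ℂ (X.map (g.restrictScalars ℤ) : Set (Fin d' → ℂ))) ∧
          d * Module.finrank ℂ (span ℂ (X.map (g.restrictScalars ℤ) : Set (Fin d' → ℂ))) ≤
            d' * Module.finrank ℂ (span ℂ (X : Set (Fin d → ℂ))) ∧
          Module.finrank ℤ ↥(X.map (g.restrictScalars ℤ)) * d' ≤
            Module.finrank ℂ (span ℂ (X.map (g.restrictScalars ℤ) : Set (Fin d' → ℂ))) *
              (d' + Module.finrank ℤ ↥(X.map (g.restrictScalars ℤ))) ∧
          ((∃ x ∈ X.map (g.restrictScalars ℤ), x ≠ 0 ∧ ∀ i, IsAlgebraic ℚ (cexp (x i))) →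
            Module.finrank ℤ ↥(X.map (g.restrictScalars ℤ)) * d' <
              Module.finrank ℂ (span ℂ (X.map (g.restrictScalars ℤ) : Set (Fin d' → ℂ))) *
                (d' + Module.finrank ℤ ↥(X.map (g.restrictScalars ℤ)))) := by
  classical
  intro K hK d
  induction d using Nat.strong_induction_on with
  | _ d ih =>
  intro hd X hX hXK hn hirr
  by_cases hA : ∃ d₁' : ℕ, d₁' < d ∧ ∃ (g : (Fin d → ℂ) →ₗ[ℂ] (Fin d₁' → ℂ))
      (g₀ : (Fin d → ℚ) →ₗ[ℚ] (Fin d₁' → ℚ)), Function.Surjective g ∧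
      (∀ v : Fin d → ℚ, g (fun j => ((v j : ℚ) : ℂ)) = fun i => ((g₀ v i : ℚ) : ℂ)) ∧
      Module.finrank ℂ (span ℂ (X.map (g.restrictScalars ℤ) : Set (Fin d₁' → ℂ))) < d₁' ∧
      d * Module.finrank ℂ (span ℂ (X.map (g.restrictScalars ℤ) : Set (Fin d₁' → ℂ))) ≤
        d₁' * Module.finrank ℂ (span ℂ (X : Set (Fin d → ℂ)))
  · -- case (a): induct through `d₁'`
    obtain ⟨d₁', hlt, g, g₀, hsurj, hrat, hn', hineq⟩ := hA
    -- rescale to an integer matrix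
    obtain ⟨N, hN, hZ⟩ := exists_common_den (fun p : Fin d₁' × Fin d => g₀ (Pi.single p.2 1) p.1)
    choose Z hZ using hZ
    have hNC : (N : ℂ) ≠ 0 := by exact_mod_cast hN.ne'
    set G : (Fin d → ℂ) →ₗ[ℂ] (Fin d₁' → ℂ) := (N : ℂ) • g with hG
    set G₀ : (Fin d → ℚ) →ₗ[ℚ] (Fin d₁' → ℚ) := (N : ℚ) • g₀ with hG₀
    have hGrat : ∀ v : Fin d → ℚ, G (fun j => ((v j : ℚ) : ℂ)) = fun i => ((G₀ v i : ℚ) : ℂ) := by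
      intro v
      rw [hG, LinearMap.smul_apply, hrat, hG₀]
      funext i; simp
    have hGsurj : Function.Surjective G := by
      intro y
      obtain ⟨x, hx⟩ := hsurj y
      refine ⟨(N : ℂ)⁻¹ • x, ?_⟩
      rw [hG, LinearMap.smul_apply, map_smul, hx, smul_smul, mul_inv_cancel₀ hNC, one_smul]
    have hGcoord : ∀ x : Fin d → ℂ, ∀ i, G x i = ∑ j, ((Z (i, j) : ℤ) : ℂ) * x j := by
      intro x i
      rw [apply_eq_sum_of_rat G G₀ hGrat x i]
      refine Finset.sum_congr rfl fun j _ => ?_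
      congr 1
      have := hZ (i, j)
      simp only at this
      rw [hG₀, LinearMap.smul_apply, Pi.smul_apply, smul_eq_mul, this]
      simp
    set X' : Submodule ℤ (Fin d₁' → ℂ) := X.map (G.restrictScalars ℤ) with hX'
    have hX'fg : X'.FG := hX.map _
    have hX'K : ∀ x ∈ X', ∀ i, x i ∈ K ∧ cexp (x i) ∈ K := by
      rintro _ ⟨x, hx, rfl⟩ i
      rw [LinearMap.restrictScalars_apply, hGcoord x i]
      exact ⟨Subalgebra.sum_mem _ fun j _ => mul_mem (intCast_mem _ _) (hXK x hx j).1,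
        cexp_sum_int_mul_mem K _ fun j => (hXK x hx j).2⟩
    have hspanX' : span ℂ (X' : Set (Fin d₁' → ℂ)) = span ℂ (X.map (g.restrictScalars ℤ) : Set (Fin d₁' → ℂ)) :=
      span_map_smul_eq X g hNC
    have hn'X' : Module.finrank ℂ (span ℂ (X' : Set (Fin d₁' → ℂ))) < d₁' := by rw [hspanX']; exact hn'
    have hd₁'pos : 0 < d₁' := lt_of_le_of_lt (Nat.zero_le _) hn'X'
    have hirr' : ∀ s : Set (Fin d₁' → ℚ), X' ≤ (ratSpan s).restrictScalars ℤ → ratSpan s = ⊤ := by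
      intro s hs
      have hGofK : ∀ v : Fin d → ℚ, G (ofK ℚ v) = ofK ℚ (G₀ v) := by
        intro v; rw [ofK_rat_eq, ofK_rat_eq, hGrat]
      have hrs : IsKRational ℚ (ratSpan s) := isKRational_ratSpan s
      obtain ⟨s'', hs''⟩ := IsKRational.comap_of_ofK G G₀ hGofK hrs
      have hs''eq : (ratSpan s).comap G = ratSpan s'' := hs''
      have hXle : X ≤ (ratSpan s'').restrictScalars ℤ := by
        intro x hx
        rw [Submodule.restrictScalars_mem, ← hs''eq, Submodule.mem_comap]
        exact hs ⟨x, hx, rfl⟩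
      have htop := hirr s'' hXle
      rw [← hs''eq] at htop
      refine eq_top_iff.mpr fun y _ => ?_
      obtain ⟨x, rfl⟩ := hGsurj y
      have : x ∈ (ratSpan s).comap G := by rw [htop]; trivial
      exact this
    obtain ⟨d'', g', g'₀, hd''pos, hsurj', hrat', hn''lt, hn''pos, hineq', hineq2', hstrict'⟩ :=
      ih d₁' hlt hd₁'pos X' hX'fg hX'K hn'X' hirr'
    have hmap : X.map ((g'.comp G).restrictScalars ℤ) = X'.map (g'.restrictScalars ℤ) := by
      rw [hX', ← Submodule.map_comp]; rfl
    refine ⟨d'', g'.comp G, g'₀.comp G₀, hd''pos, hsurj'.comp hGsurj, fun v => ?_, ?_, ?_, ?_, ?_, ?_⟩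
    · rw [LinearMap.comp_apply, hGrat, hrat']; rfl
    · rw [hmap]; exact hn''lt
    · rw [hmap]; exact hn''pos
    · rw [hmap]
      rw [hspanX'] at hineq'
      set m := Module.finrank ℂ (span ℂ (X.map (g.restrictScalars ℤ) : Set (Fin d₁' → ℂ))) with hm
      set n'' := Module.finrank ℂ (span ℂ (X'.map (g'.restrictScalars ℤ) : Set (Fin d'' → ℂ))) with hn''
      set n := Module.finrank ℂ (span ℂ (X : Set (Fin d → ℂ))) with hnn
      have hn''m : n'' ≤ m := by
        rw [hm, ← hspanX', hn'']
        have : span ℂ (X'.map (g'.restrictScalars ℤ) : Set (Fin d'' → ℂ)) = (span ℂ (X' : Set (Fin d₁' → ℂ))).map g' := by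
          rw [Submodule.map_span]; rfl
        rw [this]; exact Submodule.finrank_map_le _ _
      have hmpos : 0 < m := lt_of_lt_of_le hn''pos hn''m
      have h1 : d * n'' * (d₁' * m) ≤ d'' * n * (d₁' * m) := by
        calc d * n'' * (d₁' * m) = (d * m) * (d₁' * n'') := by ring
          _ ≤ (d₁' * n) * (d'' * m) := Nat.mul_le_mul hineq hineq'
          _ = d'' * n * (d₁' * m) := by ring
      exact Nat.le_of_mul_le_mul_right h1 (Nat.mul_pos hd₁'pos hmpos)
    · rw [hmap]; exact hineq2'
    · rw [hmap]; exact hstrict'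
  · -- case (b)
    obtain ⟨hn0, hineq, hstrict⟩ := cor_1_3_case_b h11 K hK d hd X hX hXK hn hirr hA
    have hid : X.map ((LinearMap.id : (Fin d → ℂ) →ₗ[ℂ] (Fin d → ℂ)).restrictScalars ℤ) = X := by
      have : (LinearMap.id : (Fin d → ℂ) →ₗ[ℂ] (Fin d → ℂ)).restrictScalars ℤ = LinearMap.id := rfl
      rw [this, Submodule.map_id]
    refine ⟨d, LinearMap.id, LinearMap.id, hd, Function.surjective_id, fun v => rfl, ?_, ?_, ?_, ?_, ?_⟩
    · rw [hid]; exact hn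
    · rw [hid]; exact hn0
    · rw [hid]
    · rw [hid]; exact hineq
    · rw [hid]; exact hstrict

/-- **The named fact `royWaldschmidt_quadratic_thm_0_2` follows from Théorème 1.1** of the paper
(verbatim, as the hypothesis `h11`), through Corollaire 1.3 (`cor_1_3_of_thm_1_1`), Corollaire
1.4, Théorème 0.1 and §7 (`royWaldschmidt_quadratic_thm_0_2_of_cor_1_3`).
[cite: RoyWaldschmidt1997ENS, Théorème 1.1 pp. 755–756, §1 pp. 758–760, §7] -/
theorem royWaldschmidt_quadratic_thm_0_2_of_thm_1_1
    (h11 : ∀ (K : IntermediateField ℚ ℂ), Algebra.trdeg ℚ K ≤ 1 →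
      ∀ (d₀ d₁ : ℕ), 0 < d₀ + d₁ →
      ∀ (W : Submodule K ((Fin d₀ → ℂ) × (Fin d₁ → ℂ))),
        (∀ w ∈ W, (∀ i, w.1 i ∈ K) ∧ (∀ j, w.2 j ∈ K)) →
      ∀ (Y : Submodule ℤ ((Fin d₀ → ℂ) × (Fin d₁ → ℂ))), Y.FG →
        (∀ y ∈ Y, (∀ i, y.1 i ∈ K) ∧ (∀ j, cexp (y.2 j) ∈ K)) →
      ∀ (Ya : Submodule ℤ ((Fin d₀ → ℂ) × (Fin d₁ → ℂ))), Ya ≤ Y →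
        (∀ y ∈ Ya, ∀ j, IsAlgebraic ℚ (cexp (y.2 j))) →
      2 * Module.finrank ℂ (span ℂ ((W : Set ((Fin d₀ → ℂ) × (Fin d₁ → ℂ))) ∪ (Y : Set _))) < d₀ + d₁ →
      (∀ (T₀ : Submodule ℂ (Fin d₀ → ℂ)) (T₁ : Submodule ℂ (Fin d₁ → ℂ)),
          IsKRational K T₀ → (∃ s : Set (Fin d₁ → ℚ), T₁ = ratSpan s) →
          (∀ w ∈ W, w.1 ∈ T₀ ∧ w.2 ∈ T₁) → (∀ y ∈ Y, y.1 ∈ T₀ ∧ y.2 ∈ T₁) → T₀ = ⊤ ∧ T₁ = ⊤) →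
      ∃ (d₀' d₁' : ℕ) (g : ((Fin d₀ → ℂ) × (Fin d₁ → ℂ)) →ₗ[ℂ] ((Fin d₀' → ℂ) × (Fin d₁' → ℂ))),
        0 < d₀' + d₁' ∧ Function.Surjective g ∧
        g '' {p | (∀ i, p.1 i ∈ K) ∧ p.2 = 0} = {q | (∀ i, q.1 i ∈ K) ∧ q.2 = 0} ∧
        g '' {p | p.1 = 0 ∧ ∀ j, p.2 j ∈ Set.range ((↑) : ℚ → ℂ)} =
          {q | q.1 = 0 ∧ ∀ j, q.2 j ∈ Set.range ((↑) : ℚ → ℂ)} ∧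
        2 * Module.finrank ℂ (span ℂ ((W.map (g.restrictScalars K) : Set ((Fin d₀' → ℂ) × (Fin d₁' → ℂ))) ∪
              (Y.map (g.restrictScalars ℤ) : Set _))) < d₀' + d₁' ∧
        Module.finrank K ↥(W.map (g.restrictScalars K)) <
          2 * Module.finrank ℂ (span ℂ ((W.map (g.restrictScalars K) : Set ((Fin d₀' → ℂ) × (Fin d₁' → ℂ))) ∪
              (Y.map (g.restrictScalars ℤ) : Set _))) ∧
        d₁' * (d₀ + d₁ - 2 * Module.finrank ℂ (span ℂ ((W : Set ((Fin d₀ → ℂ) × (Fin d₁ → ℂ))) ∪ (Y : Set _)))) ≤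
          d₁ * (d₀' + d₁' - 2 * Module.finrank ℂ (span ℂ ((W.map (g.restrictScalars K) :
              Set ((Fin d₀' → ℂ) × (Fin d₁' → ℂ))) ∪ (Y.map (g.restrictScalars ℤ) : Set _)))) ∧
        Module.finrank ℤ ↥(Y.map (g.restrictScalars ℤ)) *
            (d₀' + d₁' - 2 * Module.finrank ℂ (span ℂ ((W.map (g.restrictScalars K) :
              Set ((Fin d₀' → ℂ) × (Fin d₁' → ℂ))) ∪ (Y.map (g.restrictScalars ℤ) : Set _)))) ≤
          d₁' * (2 * Module.finrank ℂ (span ℂ ((W.map (g.restrictScalars K) :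
              Set ((Fin d₀' → ℂ) × (Fin d₁' → ℂ))) ∪ (Y.map (g.restrictScalars ℤ) : Set _))) -
            Module.finrank K ↥(W.map (g.restrictScalars K))) ∧
        ((d₀' < Module.finrank ℂ (span ℂ ((W.map (g.restrictScalars K) :
              Set ((Fin d₀' → ℂ) × (Fin d₁' → ℂ))) ∪ (Y.map (g.restrictScalars ℤ) : Set _))) ∨
          Module.finrank K ↥(W.map (g.restrictScalars K)) <
            Module.finrank ℂ (span ℂ ((W.map (g.restrictScalars K) :
              Set ((Fin d₀' → ℂ) × (Fin d₁' → ℂ))) ∪ (Y.map (g.restrictScalars ℤ) : Set _))) ∨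
          0 < Module.finrank ℤ ↥(Ya.map (g.restrictScalars ℤ))) →
          Module.finrank ℤ ↥(Y.map (g.restrictScalars ℤ)) *
              (d₀' + d₁' - 2 * Module.finrank ℂ (span ℂ ((W.map (g.restrictScalars K) :
                Set ((Fin d₀' → ℂ) × (Fin d₁' → ℂ))) ∪ (Y.map (g.restrictScalars ℤ) : Set _)))) <
            d₁' * (2 * Module.finrank ℂ (span ℂ ((W.map (g.restrictScalars K) :
                Set ((Fin d₀' → ℂ) × (Fin d₁' → ℂ))) ∪ (Y.map (g.restrictScalars ℤ) : Set _))) -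
              Module.finrank K ↥(W.map (g.restrictScalars K)))))
    : royWaldschmidt_quadratic_thm_0_2 :=
  royWaldschmidt_quadratic_thm_0_2_of_cor_1_3 (cor_1_3_of_thm_1_1 h11)

end RoyWaldschmidt1997

end Literature.NumberTheory.Transcendental
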